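import Summits.QuantumAdvantage.AdviceFreeQNC0.WalkPolynomialTransforms
import Summits.QuantumAdvantage.AdviceFreeQNC0.WalkCharacterInversion
import HarnessLib

/-!
# Cell qa-qnc0 (rung F-Q1, route RingFrame, crux α `RingToElim`): the SUPPORT LEMMA and the
# CODE DESCRIPTION of the full game — `M_D(P) = span{χ_a : a near the path}`,
# `Tr M_D(P) = {h Boolean : ĥ = 0 on FAR_D}` (planner qa-qnc0-p1 TARGET §15.1 / §15.5, `⊇`), and
# the converse of the FULL EXACT LAW: perfect full strategies exist on `m ≤ 2D+2` bits

The `⊆` halves are in the tree (`fullSpan_le_chiSpan`, `Lfun_tr_eq_zero_of_far`,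
`fullSpan_not_perfect`; prover qn-prover-3 gen 5).  This file proves the `⊇` halves:

* `chi_flipOn_mem_span` — MÖBIUS INVERSION of the closed form `u^T·χ_a = ω^{a(T)} Σ_{S⊆T} χ_{σ_S a}`
  (`monoF_mul_chi`): `χ_{σ_T a} ∈ span{u^S·χ_a : S ⊆ T}` (induction on `T` through the
  multiplication rule `χ_{σ_i b} = ω^{2b_i}·u_i·χ_b + χ_b`);
* **`chi_mem_fullSpan_of_nearPath`**, **`fullSpan_eq_chiSpan`** — THE SUPPORT LEMMA:
  `M_D(P) = span{χ_a : dist(a, P) ≤ D}` (TARGET §15.1);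
* `Lfun_sq` — Frobenius on the coefficient functional: `L_a(h)² = L_ā(h²)`;
* **`exists_fullSpan_tr_eq`** — THE CODE DESCRIPTION, `⊇` (TARGET §15.5): every `h` with
  `h² = h` (values in `𝔽₂`) whose coefficients vanish at every pattern `a` with `a` AND `ā` far
  from the path is `tr f` for some `f ∈ M_D(P)`; `f = Σ_{a ∈ Reps} L_a(h)·χ_a` over one
  representative of each conjugate pair `{a, ā}` meeting `N_D(P)` (ties broken by the letter at
  position `0`), using the inversion formula `h = Σ_a L_a(h) χ_a` (`sum_Lfun_mul_chi`);
* `nearPath_or_conj` — the covering radius of `P ∪ P̄` on `m ≤ 2D+2` letters is `≤ D` (cuts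
  `g ∈ {0, 1}` suffice); hence **`fullSpan_perfect_of_le`** — THE FULL EXACT LAW, upper half: for
  `m ≤ 2D+2` some `f ∈ M_D(P)` has `tr f ≡ 1` (with `fullSpan_not_perfect` at `m = 2D+3`: the
  threshold of perfect FULL play is exactly `m = 2D+2`, TARGET §15.2 / planner qa-qnc0-p2's E4,
  all `D`).

So α for the full game IS the frequency-vanishing statement of TARGET §15.5 (the equivalence is
now kernel in both directions).  The cell's theorems (planner qa-qnc0-p1 gen 3 statements and
sketches; prover qn-prover-3 gen 6 kernel proofs), 2026-08-27; standard character calculus, not in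
print in this form.  WHAT THIS IS NOT: statements about FULL strategies (free `𝔽₄[u]_{≤D}`
coefficients) — the converse for walk/ring strategies (`𝔽₂` selectors; perfect play at
`n ≤ 2D+1`, and at `n = 2D+2` for the easy charge) is observed, not proved; nothing at constant
`η`; no separation claim.
-/

noncomputable section

namespace Summit.QuantumAdvantage.AdviceFreeQNC0

open Finset
open Literature.Computability.MetaComplexity Literature.Computability.MetaComplexity.Smolensky
open F4

variable {m : ℕ}

/-! ### The support lemma, `⊇` -/

/-- Multiplying by `u_i` keeps a subcube span inside the next subcube span. -/
theorem ind_mul_mem_span_insert (T : Finset (Fin m)) (a : Fin m → Bool) (i : Fin m)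
    {f : (Fin m → Bool) → F4}
    (hf : f ∈ Submodule.span F4 {f | ∃ S, S ⊆ T ∧ f = fun u => monoF S u * chi a u}) :
    (fun u => ιF (u i) * f u) ∈
      Submodule.span F4 {f | ∃ S, S ⊆ insert i T ∧ f = fun u => monoF S u * chi a u} := by
  classical
  induction hf using Submodule.span_induction with
  | mem g hg =>
    obtain ⟨S, hS, rfl⟩ := hg
    have e : (fun u => ιF (u i) * (fun u => monoF S u * chi a u) u) =
        fun u => monoF (insert i S) u * chi a u := by
      funext u
      have h1 : ιF (u i) = monoF {i} u := by simp [monoF]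
      rw [h1, show (fun u => monoF S u * chi a u) u = monoF S u * chi a u from rfl, ← mul_assoc,
        monoF_mul_monoF, Finset.insert_eq]
    rw [e]
    exact Submodule.subset_span ⟨insert i S, Finset.insert_subset_insert i hS, rfl⟩
  | zero =>
    have e : (fun u : Fin m → Bool => ιF (u i) * (0 : (Fin m → Bool) → F4) u) = 0 := by
      funext u; simp
    rw [e]; exact Submodule.zero_mem _
  | add g h _ _ hg hh =>
    have e : (fun u => ιF (u i) * (g + h) u) = (fun u => ιF (u i) * g u) + fun u => ιF (u i) * h u := by
      funext u; simp [mul_add]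
    rw [e]; exact Submodule.add_mem _ hg hh
  | smul c g _ hg =>
    have e : (fun u => ιF (u i) * (c • g) u) = c • fun u => ιF (u i) * g u := by
      funext u; simp [smul_eq_mul]; ring
    rw [e]; exact Submodule.smul_mem _ _ hg

/-- **Möbius inversion of the closed form**: `χ_{σ_T a} ∈ span{u^S · χ_a : S ⊆ T}`. -/
theorem chi_flipOn_mem_span (T : Finset (Fin m)) (a : Fin m → Bool) :
    chi (flipOn T a) ∈ Submodule.span F4 {f | ∃ S, S ⊆ T ∧ f = fun u => monoF S u * chi a u} := by
  classical
  induction T using Finset.induction_on with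
  | empty =>
    rw [flipOn_empty]
    refine Submodule.subset_span ⟨∅, Finset.Subset.refl _, ?_⟩
    funext u
    simp [monoF]
  | insert i T hi ih =>
    -- `χ_{σ_i b} = ω^{2 b_i} · u_i · χ_b + χ_b` for `b = σ_T a`
    have hrule : chi (flipOn (insert i T) a) =
        ω ^ (2 * lett (flipOn T a i)) • (fun u => ιF (u i) * chi (flipOn T a) u) + chi (flipOn T a) := by
      rw [flipOn_insert hi]
      funext u
      rw [Pi.add_apply, Pi.smul_apply, smul_eq_mul]
      have h := ind_mul_chi (flipOn T a) i u
      have h3 : ω ^ (2 * lett (flipOn T a i)) * ω ^ lett (flipOn T a i) = 1 := by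
        rw [← pow_add, omega_pow_mod,
          show (2 * lett (flipOn T a i) + lett (flipOn T a i)) % 3 = 0 by omega, pow_zero]
      have key : ω ^ (2 * lett (flipOn T a i)) * (ιF (u i) * chi (flipOn T a) u) =
          chi (flipOn T a) u + chi (Function.update (flipOn T a) i (!(flipOn T a) i)) u := by
        rw [h, ← mul_assoc, h3, one_mul]
      linear_combination (-1 : F4) * key - (chi (flipOn T a) u) * two_eq_zero
    rw [hrule]
    have hmono : Submodule.span F4 {f | ∃ S, S ⊆ T ∧ f = fun u => monoF S u * chi a u} ≤
        Submodule.span F4 {f | ∃ S, S ⊆ insert i T ∧ f = fun u => monoF S u * chi a u} := by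
      refine Submodule.span_mono ?_
      rintro f ⟨S, hS, rfl⟩
      exact ⟨S, hS.trans (Finset.subset_insert i T), rfl⟩
    exact Submodule.add_mem _ (Submodule.smul_mem _ _ (ind_mul_mem_span_insert T a i ih)) (hmono ih)

/-- **Characters near the path are full strategies**: `dist(c, a^{(g)}) ≤ D ⇒ χ_c ∈ M_D(P)`. -/
theorem chi_mem_fullSpan_of_nearPath {D : ℕ} {c : Fin m → Bool} (hc : NearPath D c) :
    chi c ∈ fullSpan m D := by
  classical
  obtain ⟨g, hg⟩ := hc
  set T := misSet (aPat g) c with hT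
  have hflip : flipOn T (aPat g) = c := (flipOn_eq_iff T (aPat g) c).2 hT
  have hcard : T.card ≤ D := by rw [hT, card_misSet, pdist_comm]; exact hg
  rw [← hflip]
  refine (Submodule.span_le.2 ?_) (chi_flipOn_mem_span T (aPat g))
  rintro f ⟨S, hS, rfl⟩
  exact Submodule.subset_span ⟨g, S, (Finset.card_le_card hS).trans hcard, rfl⟩

/-- The span of the near characters lies in the full module. -/
theorem chiSpan_nearPath_le_fullSpan (m D : ℕ) : chiSpan (NearPath (m := m) D) ≤ fullSpan m D := by
  unfold chiSpan
  refine Submodule.span_le.2 ?_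
  rintro f ⟨a, ha, rfl⟩
  exact chi_mem_fullSpan_of_nearPath ha

/-- **THE SUPPORT LEMMA** (TARGET §15.1): `M_D(P) = span{χ_a : dist(a, P) ≤ D}`. [folklore] -/
theorem fullSpan_eq_chiSpan (m D : ℕ) : fullSpan m D = chiSpan (NearPath (m := m) D) :=
  le_antisymm (fullSpan_le_chiSpan m D) (chiSpan_nearPath_le_fullSpan m D)

/-! ### Frobenius on the coefficient functional -/

/-- Squares of sums in characteristic `2`. -/
private theorem sq_sum {ι : Type*} (s : Finset ι) (f : ι → F4) :
    (∑ i ∈ s, f i) ^ 2 = ∑ i ∈ s, f i ^ 2 := by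
  classical
  induction s using Finset.induction_on with
  | empty => simp
  | insert j s hj ih => rw [Finset.sum_insert hj, Finset.sum_insert hj, add_sq', ih]

/-- `(ω^{b})² = ω^{b̄}` for a letter `b`. -/
private theorem sq_omega_lett (b : Bool) : (ω ^ lett b) ^ 2 = ω ^ lett (!b) := by
  rw [← pow_mul, omega_pow_mod]
  cases b <;> simp [lett]

/-- **`L_a(h)² = L_ā(h²)`.** -/
theorem Lfun_sq (a : Fin m → Bool) (h : (Fin m → Bool) → F4) :
    Lfun a h ^ 2 = Lfun (conj a) (fun u => h u ^ 2) := by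
  classical
  unfold Lfun
  rw [sq_sum]
  refine Finset.sum_congr rfl fun u _ => ?_
  rw [mul_pow, ← Finset.prod_pow]
  congr 1
  refine Finset.prod_congr rfl fun i _ => ?_
  by_cases hu : u i = true
  · rw [if_pos hu, if_pos hu, one_pow]
  · rw [if_neg hu, if_neg hu, sq_omega_lett]
    rfl

/-! ### The code description, `⊇` (TARGET §15.5) -/

/-- Conjugation is an involution. -/
theorem conj_conj (a : Fin m → Bool) : conj (conj a) = a := by
  funext i; simp [conj]

/-- **THE CODE DESCRIPTION, `⊇`**: a function `h` with `h² = h` whose coefficients `L_a(h)`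
vanish whenever `a` and `ā` are both far from the path is the win pattern `tr f` of a full
strategy `f ∈ M_D(P)`. [folklore] -/
theorem exists_fullSpan_tr_eq {D : ℕ} (h : (Fin m → Bool) → F4) (hh : ∀ u, h u ^ 2 = h u)
    (hfar : ∀ a : Fin m → Bool, ¬ NearPath D a → ¬ NearPath D (conj a) → Lfun a h = 0) :
    ∃ f ∈ fullSpan m D, ∀ u, tr (f u) = h u := by
  classical
  rcases Nat.eq_zero_or_pos m with hm | hm
  · -- no letters: the cube is a point and `ω·h` works (`tr(ωh) = (ω+ω²)h = h`)
    subst hm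
    have hgen : (fun u : Fin 0 → Bool => monoF (∅ : Finset (Fin 0)) u * chi (aPat 0) u) =
        fun _ => 1 := by
      funext u; simp [monoF, chi]
    refine ⟨fun u => ω * h u, ?_, fun u => ?_⟩
    · have e : (fun u : Fin 0 → Bool => ω * h u) =
          (ω * h (fun i => Fin.elim0 i)) • fun u => monoF (∅ : Finset (Fin 0)) u * chi (aPat 0) u := by
        funext u
        have hu : u = fun i => Fin.elim0 i := funext fun i => Fin.elim0 i
        rw [hgen, Pi.smul_apply, smul_eq_mul, mul_one, hu]
      rw [e]
      exact Submodule.smul_mem _ _ (Submodule.subset_span ⟨0, ∅, by simp, rfl⟩)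
    · unfold tr
      rw [mul_pow, hh u, ← add_mul, omega_add_omega_sq, one_mul]
  · -- representatives of the conjugate pairs meeting `N_D(P)`, ties broken at position `0`
    set i₀ : Fin m := ⟨0, hm⟩ with hi₀
    set R : Finset (Fin m → Bool) :=
      univ.filter fun a => NearPath D a ∧ (NearPath D (conj a) → a i₀ = false) with hR
    set f : (Fin m → Bool) → F4 := fun u => ∑ a ∈ R, Lfun a h * chi a u with hf
    refine ⟨f, ?_, fun u => ?_⟩
    · have e : f = ∑ a ∈ R, (Lfun a h • chi a) := by
        funext u; simp only [hf, Finset.sum_apply, Pi.smul_apply, smul_eq_mul]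
      rw [e]
      refine Submodule.sum_mem _ fun a ha => Submodule.smul_mem _ _ ?_
      exact chi_mem_fullSpan_of_nearPath (Finset.mem_filter.1 ha).2.1
    · -- `tr f = Σ_R L_a h χ_a + Σ_R L_ā h χ_ā = Σ_a L_a h χ_a = h`
      have hsq : f u ^ 2 = ∑ a ∈ R, Lfun (conj a) h * chi (conj a) u := by
        rw [hf]
        dsimp only
        rw [sq_sum]
        refine Finset.sum_congr rfl fun a _ => ?_
        rw [mul_pow, Lfun_sq, chi_sq]
        congr 1
        exact congrArg (Lfun (conj a)) (funext hh)
      have hexcl : ∀ a, a ∈ R → conj a ∈ R → False := by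
        intro a ha ha'
        rw [hR, Finset.mem_filter] at ha ha'
        rw [conj_conj] at ha'
        have h1 := ha.2.2 ha'.2.1
        have h2 := ha'.2.2 ha.2.1
        simp [conj, h1] at h2
      have hzero : ∀ a, a ∉ R → conj a ∉ R → Lfun a h * chi a u = 0 := by
        intro a ha ha'
        have hna : ¬ NearPath D a := by
          intro hna
          have h1 : NearPath D (conj a) ∧ a i₀ ≠ false := by
            by_contra hcon
            apply ha
            rw [hR, Finset.mem_filter]
            refine ⟨Finset.mem_univ _, hna, fun hc => ?_⟩
            by_contra hai
            exact hcon ⟨hc, hai⟩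
          apply ha'
          rw [hR, Finset.mem_filter]
          refine ⟨Finset.mem_univ _, h1.1, fun _ => ?_⟩
          show (!a i₀) = false
          cases hx : a i₀
          · exact absurd hx h1.2
          · rfl
        have hnc : ¬ NearPath D (conj a) := by
          intro hnc
          apply ha'
          rw [hR, Finset.mem_filter]
          refine ⟨Finset.mem_univ _, hnc, fun hca => ?_⟩
          rw [conj_conj] at hca
          exact absurd hca hna
        rw [hfar a hna hnc, zero_mul]
      -- assemble
      have hsplit : ∀ a : Fin m → Bool, Lfun a h * chi a u =
          (if a ∈ R then Lfun a h * chi a u else 0) + (if conj a ∈ R then Lfun a h * chi a u else 0) := by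
        intro a
        by_cases h1 : a ∈ R
        · rw [if_pos h1, if_neg (fun h2 => hexcl a h1 h2), add_zero]
        · by_cases h2 : conj a ∈ R
          · rw [if_neg h1, if_pos h2, zero_add]
          · rw [if_neg h1, if_neg h2, add_zero, hzero a h1 h2]
      have htot := sum_Lfun_mul_chi h u
      rw [Finset.sum_congr rfl fun a _ => hsplit a, Finset.sum_add_distrib, Finset.sum_ite_mem,
        Finset.univ_inter] at htot
      have hconj : ∑ a : Fin m → Bool, (if conj a ∈ R then Lfun a h * chi a u else 0) =
          ∑ a ∈ R, Lfun (conj a) h * chi (conj a) u := by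
        have hinv : Function.Involutive (conj (m := m)) := conj_conj
        rw [← Equiv.sum_comp hinv.toPerm (fun a => if conj a ∈ R then Lfun a h * chi a u else 0)]
        simp only [Function.Involutive.coe_toPerm, conj_conj]
        rw [Finset.sum_ite_mem, Finset.univ_inter]
      rw [hconj] at htot
      unfold tr
      rw [hsq, ← htot]

/-! ### Covering radius and the converse of the full exact law -/

/-- `dist(x, 1^m) = #{i : x_i = 2}`. -/
private theorem pdist_aPat_zero (x : Fin m → Bool) :
    pdist x (aPat 0) = (univ.filter fun i : Fin m => x i = true).card := by
  unfold pdist aPat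
  congr 1
  refine Finset.filter_congr fun i _ => ?_
  simp

/-- Moving the cut past position `0` changes the distance by one, down iff `x₀ = 2`. -/
private theorem pdist_aPat_one {m : ℕ} (x : Fin (m + 1) → Bool) :
    pdist x (aPat 1) + (if x 0 = true then 1 else 0) = pdist x (aPat 0) + (if x 0 = true then 0 else 1) := by
  classical
  unfold pdist
  rw [Finset.card_filter, Finset.card_filter, Fin.sum_univ_succ, Fin.sum_univ_succ]
  have htail : ∀ j : Fin m, (if x j.succ ≠ aPat 1 j.succ then 1 else 0) =
      (if x j.succ ≠ aPat 0 j.succ then 1 else 0) := by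
    intro j
    have h1 : aPat (m := m + 1) 1 j.succ = false := by simp [aPat]
    have h0 : aPat (m := m + 1) 0 j.succ = false := by simp [aPat]
    rw [h1, h0]
  rw [Finset.sum_congr rfl fun j _ => htail j]
  have h10 : aPat (m := m + 1) 1 0 = true := by simp [aPat]
  have h00 : aPat (m := m + 1) 0 0 = false := by simp [aPat]
  rw [h10, h00]
  cases x 0 <;> simp [add_comm]

/-- **Covering radius**: on `m ≤ 2D+2` letters every pattern or its conjugate is within distance
`D` of the path (cuts `g ∈ {0,1}` suffice). -/
theorem nearPath_or_conj {D : ℕ} (hm : m ≤ 2 * D + 2) (a : Fin m → Bool) :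
    NearPath D a ∨ NearPath D (conj a) := by
  classical
  have hsum : pdist a (aPat 0) + pdist (conj a) (aPat 0) = m := by
    rw [pdist_aPat_zero, pdist_aPat_zero]
    have e : (univ.filter fun i : Fin m => conj a i = true) = univ.filter fun i : Fin m => ¬ a i = true :=
      Finset.filter_congr fun i _ => by simp [conj]
    rw [e, Finset.card_filter_add_card_filter_not, Finset.card_univ, Fintype.card_fin]
  by_cases h0 : pdist a (aPat 0) ≤ D
  · exact Or.inl ⟨0, h0⟩
  by_cases h1 : pdist (conj a) (aPat 0) ≤ D
  · exact Or.inr ⟨0, h1⟩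
  -- the critical case `m = 2D+2`, `dist = D+1`: move the cut past position `0`
  obtain ⟨m', rfl⟩ : ∃ m', m = m' + 1 := ⟨m - 1, by omega⟩
  have ha := pdist_aPat_one a
  have hc := pdist_aPat_one (conj a)
  have hc0 : conj a 0 = !a 0 := rfl
  rw [hc0] at hc
  cases h : a 0
  · rw [h] at ha hc
    simp only [Bool.false_eq_true, if_false, Bool.not_false, if_true, add_zero] at ha hc
    exact Or.inr ⟨1, by omega⟩
  · rw [h] at ha hc
    simp only [if_true, Bool.not_true, Bool.false_eq_true, if_false, add_zero] at ha hc
    exact Or.inl ⟨1, by omega⟩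

/-- **THE FULL EXACT LAW, upper half**: on `m ≤ 2D+2` bits some full strategy `f ∈ M_D(P)` is
perfect, `tr f ≡ 1` (with `fullSpan_not_perfect`: the threshold is exactly `2D+2`; TARGET §15.2,
planner qa-qnc0-p2's E4, all `D`). [folklore] -/
theorem fullSpan_perfect_of_le {D : ℕ} (hm : m ≤ 2 * D + 2) :
    ∃ f ∈ fullSpan m D, ∀ u, tr (f u) = 1 :=
  exists_fullSpan_tr_eq (fun _ => (1 : F4)) (fun _ => by rw [one_pow])
    (fun a ha ha' => absurd (nearPath_or_conj hm a) (by tauto))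

end Summit.QuantumAdvantage.AdviceFreeQNC0

end
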